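import Mathlib.FieldTheory.Finite.GaloisField
import Mathlib.LinearAlgebra.Lagrange
import Mathlib.LinearAlgebra.Dimension.Free
import Literature.Computability.Complexity.KWiseIndependenceFoolsReaders
import Literature.Computability.Complexity.GF2Circuits
import HarnessLib

/-!
# A `k`-wise uniform family of Boolean functions from polynomials over `GF(2ⁿ)`

The classical `k`-wise independent family: identify the cube `{0,1}ⁿ` with the field
`𝔽 = GF(2ⁿ)` through a fixed `𝔽₂`-basis, and send a coefficient vector `a ∈ 𝔽ᵏ` to the Boolean
function `x ↦ ⟨first coordinate of Σ_{j<k} aⱼ · x^j⟩`. Over a uniformly random `a`, the values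
at any `k` distinct points are independent uniform bits (Lagrange interpolation: the evaluation
map `𝔽[X]_{<k} → 𝔽^S` at `|S| ≤ k` distinct nodes is onto; a surjective homomorphism of finite
groups has fibres of equal size).

* `PolyFamily.basis`, `PolyFamily.enc` (injective), `PolyFamily.peval`, `PolyFamily.coord0`,
  `PolyFamily.fam hn k : (Fin k → GF(2ⁿ)) → ({0,1}ⁿ → Bool)` — the family;
* `PolyFamily.exists_coeffs_eq` — interpolation: every pattern of first coordinates on at most
  `k` points is realised;
* **`PolyFamily.isKWiseUniform_fam`** — the family is `k`-wise uniform in the sense of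
  `Literature.Computability.Complexity.IsKWiseUniform` (so it fools every stable reader of at most
  `k` cells, `IsStableReader.card_seeds_mul_eq`);
* `PolyFamily.card_seeds` — there are `2^{n k}` seeds.

The circuit size of the members (Horner's rule over `GF(2ⁿ)`, `O(k · n³)` gates) is the business
of a companion file.

## References

* Folklore; A. Joffe, *On a set of almost deterministic `k`-independent random variables*, Ann.
  Probab. 2 (1974) 161–162 (polynomial construction); N. Alon, L. Babai, A. Itai, J. Algorithms 7
  (1986), §3. Interpolation: Mathlib `Lagrange.interpolate`.
-/

noncomputable section

namespace Literature.Computability.Complexity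

open Finset Polynomial

namespace PolyFamily

variable {n : ℕ}

/-- The field `GF(2ⁿ)`. [folklore] -/
abbrev 𝔽 (n : ℕ) : Type := GaloisField 2 n

/-- `GF(2ⁿ)` is finite (`Fintype.ofFinite`). [folklore] -/
noncomputable instance instFintype𝔽 (n : ℕ) : Fintype (𝔽 n) := Fintype.ofFinite _

/-- Classical decidable equality on `GF(2ⁿ)`. [folklore] -/
noncomputable instance instDecidableEq𝔽 (n : ℕ) : DecidableEq (𝔽 n) := Classical.decEq _

/-- A fixed `𝔽₂`-basis of `GF(2ⁿ)` indexed by `Fin n` (`[GF(2ⁿ) : 𝔽₂] = n`,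
`GaloisField.finrank`). [folklore] -/
def basis (hn : n ≠ 0) : Module.Basis (Fin n) (ZMod 2) (𝔽 n) :=
  Module.finBasisOfFinrankEq (ZMod 2) (𝔽 n) (GaloisField.finrank 2 (n := n) hn)

/-- The encoding of a point of the cube `{0,1}ⁿ` as the field element with these coordinates. [folklore] -/
def enc (hn : n ≠ 0) (x : Fin n → Bool) : 𝔽 n := (basis hn).equivFun.symm fun i => bitZ (x i)

/-- The encoding is injective. [folklore] -/
theorem enc_injective (hn : n ≠ 0) : Function.Injective (enc hn) := by
  intro x y h
  have h' := (basis hn).equivFun.symm.injective h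
  funext i
  have := congrFun h' i
  simpa using congrArg zBit this

/-- Evaluation of the polynomial with coefficient vector `a ∈ 𝔽ᵏ` at `u`, by Horner's rule from the
top coefficient: `peval (a₀, a₁, …) u = a₀ + u · peval (a₁, …) u = Σ_{j<k} aⱼ uʲ` (`peval_eq_sum`).
The recursion is the shape of the evaluating circuit of the companion file. [folklore] -/
def peval : (k : ℕ) → (Fin k → 𝔽 n) → 𝔽 n → 𝔽 n
  | 0, _, _ => 0
  | k + 1, a, u => a 0 + u * peval k (fun j => a j.succ) u

/-- Horner's rule computes the polynomial: `peval a u = Σ_{j<k} aⱼ uʲ`. [folklore] -/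
theorem peval_eq_sum : ∀ (k : ℕ) (a : Fin k → 𝔽 n) (u : 𝔽 n),
    peval k a u = ∑ j : Fin k, a j * u ^ (j : ℕ)
  | 0, a, u => by simp [peval]
  | k + 1, a, u => by
    rw [peval, peval_eq_sum k, Fin.sum_univ_succ, Finset.mul_sum]
    simp only [Fin.val_zero, pow_zero, mul_one, Fin.val_succ, pow_succ]
    congr 1
    exact Finset.sum_congr rfl fun j _ => by ring

/-- The first coordinate of a field element in the fixed basis. [folklore] -/
def coord0 (hn : n ≠ 0) (z : 𝔽 n) : ZMod 2 := (basis hn).equivFun z ⟨0, Nat.pos_of_ne_zero hn⟩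

/-- **The family**: seed `a ∈ GF(2ⁿ)ᵏ` ↦ the Boolean function
`x ↦ (first coordinate of Σ_{j<k} aⱼ · enc(x)^j)`. [cite: AlonBabaiItai1986, §3] -/
def fam (hn : n ≠ 0) (k : ℕ) (a : Fin k → 𝔽 n) : (Fin n → Bool) → Bool :=
  fun x => zBit (coord0 hn (peval k a (enc hn x)))

/-- `peval` is additive in the coefficient vector. [folklore] -/
theorem peval_add (k : ℕ) (a b : Fin k → 𝔽 n) (u : 𝔽 n) :
    peval k (a + b) u = peval k a u + peval k b u := by
  simp [peval_eq_sum, add_mul, sum_add_distrib]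

/-- `peval` of the zero vector is zero. [folklore] -/
@[simp] theorem peval_zero (k : ℕ) (u : 𝔽 n) : peval k 0 u = 0 := by
  simp [peval_eq_sum]

/-- `coord0` is additive. [folklore] -/
theorem coord0_add (hn : n ≠ 0) (z w : 𝔽 n) : coord0 hn (z + w) = coord0 hn z + coord0 hn w := by
  simp [coord0, map_add]

/-- The first coordinate of `c • b₀` is `c`. [folklore] -/
theorem coord0_smul_basis (hn : n ≠ 0) (c : ZMod 2) :
    coord0 hn (c • basis hn ⟨0, Nat.pos_of_ne_zero hn⟩) = c := by
  simp [coord0, Module.Basis.equivFun_apply, Module.Basis.repr_self]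

/-- The pattern map of a finite set of points: seed ↦ (first coordinates of the values at the
points of `S`), an additive homomorphism `𝔽ᵏ → 𝔽₂^S`. [folklore] -/
def patternHom (hn : n ≠ 0) (k : ℕ) (S : Finset (Fin n → Bool)) :
    (Fin k → 𝔽 n) →+ (S → ZMod 2) where
  toFun a := fun x => coord0 hn (peval k a (enc hn x))
  map_zero' := by
    funext x
    simp [coord0]
  map_add' a b := by
    funext x
    simp only [Pi.add_apply, peval_add, coord0_add]

/-- Unfolding the pattern map. [folklore] -/
@[simp] theorem patternHom_apply (hn : n ≠ 0) (k : ℕ) (S : Finset (Fin n → Bool))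
    (a : Fin k → 𝔽 n) (x : S) : patternHom hn k S a x = coord0 hn (peval k a (enc hn x)) := rfl

/-- **Interpolation**: on at most `k` points, every pattern of first coordinates is realised by
some seed (Lagrange interpolation through the values `t(x) • b₀`). [folklore] -/
theorem exists_coeffs_eq (hn : n ≠ 0) (k : ℕ) (S : Finset (Fin n → Bool)) (hS : S.card ≤ k)
    (t : S → ZMod 2) : ∃ a : Fin k → 𝔽 n, patternHom hn k S a = t := by
  classical
  rcases Nat.eq_zero_or_pos k with hk | hk
  · subst hk
    have hSe : S = ∅ := Finset.card_eq_zero.1 (Nat.le_zero.1 hS)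
    refine ⟨0, funext fun x => ?_⟩
    exact absurd x.2 (by simp [hSe])
  -- target field values
  set b₀ : 𝔽 n := basis hn ⟨0, Nat.pos_of_ne_zero hn⟩ with hb₀
  let r : (Fin n → Bool) → 𝔽 n := fun x => if hx : x ∈ S then t ⟨x, hx⟩ • b₀ else 0
  have hinj : Set.InjOn (enc hn) S := (enc_injective hn).injOn
  set p : (𝔽 n)[X] := Lagrange.interpolate S (enc hn) r with hp
  have hdeg : p.degree < S.card := Lagrange.degree_interpolate_lt r hinj
  have hnat : p.natDegree < k := by
    by_cases hp0 : p = 0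
    · rw [hp0, natDegree_zero]; exact hk
    · rw [natDegree_lt_iff_degree_lt hp0]
      exact lt_of_lt_of_le hdeg (by exact_mod_cast hS)
  refine ⟨fun j => p.coeff j, funext fun x => ?_⟩
  have heval : peval k (fun j : Fin k => p.coeff j) (enc hn x) = p.eval (enc hn x) := by
    rw [peval_eq_sum, eval_eq_sum_range' hnat]
    exact (Fin.sum_univ_eq_sum_range (fun i => p.coeff i * enc hn x ^ i) k)
  rw [patternHom_apply, heval, hp, Lagrange.eval_interpolate_at_node r hinj x.2]
  simp only [r, dif_pos x.2]
  exact coord0_smul_basis hn _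

/-- There are `2^{|S|}` patterns on `S`. [folklore] -/
theorem card_patterns (S : Finset (Fin n → Bool)) : Fintype.card (S → ZMod 2) = 2 ^ S.card := by
  simp [ZMod.card]

/-- **The family is `k`-wise uniform**: on every set `S` of at most `k` points, every Boolean
pattern is produced by exactly a `2^{-|S|}` fraction of the seeds. [cite: AlonBabaiItai1986, §3 (k-wise independence from polynomials / codes)] -/
theorem isKWiseUniform_fam (hn : n ≠ 0) (k : ℕ) : IsKWiseUniform k (fam hn k) := by
  classical
  intro S hS z
  -- the sought seeds form the fibre of the pattern map over `t`
  let t : S → ZMod 2 := fun x => bitZ (z x)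
  have hfilter : (univ.filter fun a : Fin k → 𝔽 n => ∀ i ∈ S, fam hn k a i = z i) =
      univ.filter fun a => patternHom hn k S a = t := by
    ext a
    simp only [mem_filter, mem_univ, true_and]
    constructor
    · intro h
      funext x
      rw [patternHom_apply]
      have := h x x.2
      rw [fam] at this
      show _ = bitZ (z x)
      rw [← this, bitZ_zBit]
    · intro h i hi
      have := congrFun h ⟨i, hi⟩
      rw [patternHom_apply] at this
      rw [fam]
      simp only at this
      rw [this]
      exact zBit_bitZ _
  rw [hfilter]
  -- all fibres have the same size (surjective homomorphism of finite groups)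
  have hsurj : Function.Surjective (patternHom hn k S) := fun t' => exists_coeffs_eq hn k S hS t'
  have hfib : ∀ t' : S → ZMod 2, #{a : Fin k → 𝔽 n | patternHom hn k S a = t'} =
      #{a : Fin k → 𝔽 n | patternHom hn k S a = t} := fun t' =>
    AddMonoidHom.card_fiber_eq_of_mem_range (patternHom hn k S) (hsurj t') (hsurj t)
  have hcard : Fintype.card (Fin k → 𝔽 n) =
      Fintype.card (S → ZMod 2) * #{a : Fin k → 𝔽 n | patternHom hn k S a = t} := by
    rw [← Finset.card_univ, Finset.card_eq_sum_card_fiberwise (f := patternHom hn k S) (t := univ)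
      (fun a _ => mem_univ _)]
    simp_rw [hfib, sum_const, smul_eq_mul, Finset.card_univ]
  rw [hcard, card_patterns, mul_comm]

/-- The number of seeds is `2^{n k}`. [folklore] -/
theorem card_seeds (hn : n ≠ 0) (k : ℕ) : Fintype.card (Fin k → 𝔽 n) = 2 ^ (n * k) := by
  rw [Fintype.card_fun, Fintype.card_fin, ← Nat.card_eq_fintype_card, GaloisField.card 2 n hn,
    pow_mul]

end PolyFamily

end Literature.Computability.Complexity
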